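import Summits.PneNP.PneNP.Theses.UniformStream
import Summits.PneNP.PneNP.Theorems.UniformStreamUniformMagnificationStubSpeedup
import Summits.PneNP.PneNP.Theorems.UniformStreamUniformMagnificationStubGoodProg
import Summits.PneNP.PneNP.Theorems.UniformStreamUniformMagnificationStubSeed
import Summits.PneNP.PneNP.Theorems.UniformStreamUniformMagnificationPadCoreC
import Summits.PneNP.PneNP.Theorems.UniformStreamUniformMagnificationStubSearchStream
import Summits.PneNP.PneNP.Theorems.UniformStreamUniformMagnificationStubPadAssembly
import Summits.PneNP.PneNP.Theorems.UniformStreamUniformMagnificationStubWrapperGlue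
import Literature.Computability.Complexity.ClayProblemProofs

/-!
# Route UniformStream — crux `UniformMagnification` (stmt-PneNP-16047): McKay–Murray–Williams 2019, Thm. 1.3

`Summit.PneNP.PneNP.Theses.UniformStream.UniformMagnification`: if `¬ PneNP` then for every time-constructible
size function `s` there are `c` and ONE uniform one-pass streaming algorithm — a `StreamingAlgorithm` `A` with
three Mathlib `TM2` machines computing its init / update / accept maps, space AND steps `s(⌊log₂N⌋)^c + c` for
every input length `N` — deciding `MCSPSize s` (McKay–Murray–Williams, STOC 2019, Thm. 1.3 in the contrapositive,
typed in the tree's model; the upper-bound direction of hardness magnification for `MCSP[s]`).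

## The proof (line `registered` of the crux, lead-reshaped; all pieces landed as `--supports` files and imported)

* `stub_goodProg` (`…StubGoodProg.lean`): circuits of size `≤ t` are certified by CLEAN PROGRAMS of the tree's
  circuit-evaluation machine (`CircEval.isClean`, `tabCount ≤ t ∧ t ≠ 0`, or a rotation code = a projection):
  soundness (`CircEval.exists_circuit_evalFn`), completeness with the length bound `(t+1)(8(n+t)+10)+2n`
  (`CircEval.progOf`), and decidability of goodness in `P`.
* `stub_searchStream` (`…StubSearchStream.lean`, helpers `…Variants160473–160475`): MMW's Algorithm 1 with block
  length 1 UNDER `NP ⊆ P`: a one-pass word compressor `(ι, δ, α)` for `MCSPSize s` with `ι, δ ∈ FP`, `α ∈ P`, whose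
  state keeps a good program whose table extends the prefix read so far; the next program is found by the
  certificate search of Arora–Barak Thm. 2.18 (`exists_searchFn_of_NP_subset_P`) on the relation "good ∧ agrees with
  the current program on all earlier rows ∧ has the new bit at the current row", a `P ∩ coNP` relation that the
  collapse puts in `P`; correctness is the Myhill–Nerode argument; fixed-width fields make `δ` non-lengthening.
  (This replaces MMW's `Σ₃ᵖ`-oracle streaming algorithm of Thm. 1.2 followed by `P = NP ⇒ PH = P`: no oracle
  machine is programmed.)
* `stub_seed` (`…StubSeed.lean`): ONE machine writes the seed `⟨⟨tail (bin N), 1^{s ⌊log₂N⌋}⟩, bin N⟩` from `bin N`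
  within `s(⌊log₂N⌋)^c + c` steps (the unary clock of `s`, `exists_unaryClock_of_timeConstructible`, under
  `mapFstAux`) — where time-constructibility is consumed.
* The MODEL STEP. The update machine reads `⟨st, b⟩` (length `2|st|+3`) and must halt within `S N ≥ |st|` steps for
  EVERY `N`, so it must run in time about `|st|`: `stub_speedup` (`…StubSpeedup.lean`) is the linear speed-up
  theorem for Mathlib `TM2` over `{0,1}` (every `TM2ComputableAux Bool Bool` runs `D` times faster up to
  `(|in|+|out|)/D + 3`, via `TM2Flat` and a `D`-unrolled flat-program compiler with multi-pop statements);
  `stub_padCore` (`…PadCoreC.lean`, helpers `…Variants160471/2`) and `stub_padAssembly` (`…StubPadAssembly.lean`)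
  build LINEAR-TIME machines updating PADDED states `⟨st, 1ᵀ⟩`: a stack program parses the state, computes
  `⌊log₂(|st|+1)⌋`, `⌊log₂(T+1)⌋` by iterated halving and runs the compressor's `δ` (`mapFstAux (flagAux M_δ)`) only
  under the guard `k(⌊log₂(|st|+1)⌋+1) ≤ ⌊log₂(T+1)⌋`, which makes `δ`'s polynomial time linear in the padded length
  (junk or under-padded states get a short dead word, so the space bound holds for ALL states);
  `stub_wrapperGlue` (`…StubWrapperGlue.lean`) pads the initial state by `poly` ones (an `FP` map), speeds the padded
  machines up so that they halt within `|ST|/2 + 4 ≤ S N` steps, proves `HasSpace` and `Decides` (padded run =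
  plain run paired with `1ᵀ`), and absorbs every polynomial bound into `c`.
* Here: `¬PneNP ⇒ NP ⊆ P` by the model bridges `P_bool_eq_holds`, `NP_bool_eq_holds`, and the composition.

References: D. M. McKay, C. D. Murray, R. R. Williams, *Weak lower bounds on resource-bounded compression imply
strong separations of complexity classes*, STOC 2019, Thm. 1.2–1.3, §4 (Algorithm 1), §5 [MckayMurrayWilliams2019];
S. Arora, B. Barak, *Computational Complexity* (2009), Thm. 2.18, Thm. 5.4, Claim 1.6, §1.3 [AroraBarakCC2009];
J. Hartmanis, R. E. Stearns, *On the computational complexity of algorithms*, Trans. AMS 117 (1965) (linear speed-up).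
-/

namespace Summit.PneNP.PneNP.Cruxes.UniformMagnification.Birth

set_option linter.dupNamespace false -- `Summit.PneNP.PneNP.…`: summit = sub-problem (D-0017)

open _root_.Computability
open Literature.Computability.Complexity Literature.Computability.MetaComplexity

/-- `¬ PneNP` puts `NP` inside `P` in the prelude's classes (model bridges `P_bool_eq_holds`, `NP_bool_eq_holds`:
the summit statement is phrased over `PNPWave0.P/NP`). [cite: AroraBarakCC2009, Thm. 5.4] -/
theorem NP_subset_P_of_not_pneNP (hnp : ¬ _root_.PneNP) : Nondeterministic.NP ⊆ Classes.P := by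
  have hP : PNPWave0.P Bool = Classes.P := P_bool_eq_holds
  have hNP : PNPWave0.NP Bool = Nondeterministic.NP := NP_bool_eq_holds
  by_contra hcon
  obtain ⟨L, hL, hLP⟩ := Set.not_subset.1 hcon
  apply hnp
  show ∃ L : Language Bool, L ∈ PNPWave0.NP Bool ∧ L ∉ PNPWave0.P Bool
  exact ⟨L, by rw [hNP]; exact hL, by rw [hP]; exact hLP⟩

end Summit.PneNP.PneNP.Cruxes.UniformMagnification.Birth

namespace Summit.PneNP.PneNP.Theorems

set_option linter.dupNamespace false -- `Summit.PneNP.PneNP.…`: summit = sub-problem (D-0017)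

open _root_.Computability
open Literature.Computability.Complexity Literature.Computability.MetaComplexity
open Summit.PneNP.PneNP.Cruxes.UniformMagnification.Birth

/-- **Crux `UniformMagnification` of route UniformStream (stmt-PneNP-16047) — McKay–Murray–Williams 2019, Thm. 1.3,
typed in the tree's model.** If `¬ PneNP` then for every time-constructible `s` some `c` and ONE uniform one-pass
streaming algorithm (init / update / accept `TM2` machines within `s(⌊log₂N⌋)^c + c` space and steps) decide
`MCSPSize s`. Proof: `¬PneNP ⇒ NP ⊆ P` (`NP_subset_P_of_not_pneNP`); the search compressor of `stub_searchStream`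
(fed with `stub_goodProg`); the model step `stub_wrapperGlue` fed with the linear speed-up `stub_speedup`, the
padded machines `stub_padAssembly stub_padCore`, and the seed machine `stub_seed`.
[cite: MckayMurrayWilliams2019, Thm. 1.3 (and Thm. 1.2, §4 Algorithm 1, §5)] -/
theorem uniformStream_uniformMagnification_proof :
    Summit.PneNP.PneNP.Theses.UniformStream.UniformMagnification := by
  intro hnp s hs
  have hNP : Nondeterministic.NP ⊆ Classes.P := NP_subset_P_of_not_pneNP hnp
  obtain ⟨ι, δ, α, hι, hδ, hα, hdec, hinit, hupd⟩ :=
    stub_searchStream stub_goodProg.1 stub_goodProg.2.1 stub_goodProg.2.2 s hs.1 hNP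
  exact stub_wrapperGlue stub_speedup (stub_padAssembly stub_padCore) s hs.1 (MCSPSize s) ι δ α hdec hinit hupd
    hι hδ hα (stub_seed s hs)

end Summit.PneNP.PneNP.Theorems
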